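import Literature.RepresentationTheory.ClassicalInvariants.OnSpDualityOperators
import Mathlib.Data.Matrix.Block
import Mathlib.LinearAlgebra.Matrix.NonsingularInverse
import HarnessLib

/-!
# Kashiwara–Vergne (1978), Ch. III (5.1): invariance of the pluriharmonic system under
# `GL(p) × GL(q) × GL(k)`

M. Kashiwara, M. Vergne, *On the Segal–Shale–Weil representations and harmonic polynomials*,
Invent. Math. 44 (1978), Ch. III § 5, (5.1) p. 41 [KashiwaraVergne1978]: "We consider the system of
differential equations `(Δ_{ij} f)(x, y) = 0` for `1 ≤ i ≤ p, 1 ≤ j ≤ q` where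
`Δ_{i,j} = Σ_{ν=1}^{k} ∂²/∂x_{iν}∂y_{jν}`; `x ∈ M(p,k;ℂ)`, `y ∈ M(q,k;ℂ)`. […] The group
`GL(p,ℂ) × GL(q,ℂ) × GL(k,ℂ)` acts on `M(p,k;ℂ) × M(q,k;ℂ)` by `(g₁, g₂, c)·(x, y) → (g₁xc⁻¹, ᵗg₂⁻¹yᵗc)`.
The system (5.1) is invariant by this action; so `𝔥` is a representation space of
`GL(p,ℂ) × GL(q,ℂ) × GL(k,ℂ)`."

Polynomials on `M(p,k) × M(q,k)` are `MvPolynomial ((ιx ⊕ ιy) × κ) R` (`x_{iν} = X (inl i, ν)`,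
`y_{jν} = X (inr j, ν)`), over any commutative ring `R`, for every `k = |κ|` (the tree's
`KashiwaraVergne1978.PluriharmonicPolynomials` treats `k = 1`). The operators `Δ_ij` and the quadrics
`(xᵗy)_{ij} = Σ_ν x_{iν} y_{jν}` enter as hypotheses (`hΔ`, `hT`), substitutions as `aeval v` with
`v` described by a hypothesis (`hv`, `hw`). Everything is proved; no definitions.

* § 1 `pderiv_aeval_colSubst` — the chain rule for a substitution of the column index,
  `(x, y) ↦ (x·Bx, y·By)` (row-block-dependent matrices `B u`): `∂_{(u,ν′)}(f∘w) = Σ_ν B_u ν′ ν (∂_{(u,ν)} f)∘w`;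
* § 2 **row action** `(x, y) ↦ (A x, B y)` (block-diagonal substitution of the row index, via
  `OnSpDualityOperators.pderiv_aeval_linSubst`): `laplacianKV_aeval_rowSubst` —
  `Δ_ij(f∘v) = Σ_{i′j′} A_{i′i} B_{j′j} (Δ_{i′j′} f)∘v`, hence `isPluriharmonic_aeval_rowSubst` — `𝔥` is
  stable; `aeval_rowSubst_T` — `(xᵗy)_{ij}∘v = Σ A_{ii′} B_{jj′} (xᵗy)_{i′j′}`;
* § 3 **column action** `(x, y) ↦ (x·Bx, y·By)` with `Bxᵀ By = 1` (the book's `(xc⁻¹, yᵗc)`):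
  `laplacianKV_aeval_colSubst` — `Δ_ij(f∘w) = (Δ_ij f)∘w` (each `Δ_ij` is invariant), hence
  `isPluriharmonic_aeval_colSubst`; `aeval_colSubst_T` — `(xᵗy)_{ij}∘w = (xᵗy)_{ij}`.

References: M. Kashiwara, M. Vergne, Invent. Math. 44 (1978) 1–47, Ch. III (5.1)–(5.2), pp. 41–42
[KashiwaraVergne1978].
-/

open MvPolynomial
open scoped BigOperators

universe u v v' w

namespace Literature.RepresentationTheory.KashiwaraVergne1978.PluriharmonicInvariance

variable {R : Type u} [CommRing R] {ιx : Type v} {ιy : Type v} {κ : Type w}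
  [Fintype ιx] [Fintype ιy] [Fintype κ] [DecidableEq ιx] [DecidableEq ιy] [DecidableEq κ]

/-! ## § 0. Helpers -/

omit [Fintype ιx] [Fintype ιy] [Fintype κ] in
/-- `∂_{(u,ν)} x_{(u′,ν′)} = δ δ`. [folklore] -/
private theorem pderiv_X_pair (u u' : ιx ⊕ ιy) (ν ν' : κ) :
    pderiv (u, ν) (X (u', ν') : MvPolynomial ((ιx ⊕ ιy) × κ) R) =
      if u' = u ∧ ν' = ν then 1 else 0 := by
  rw [pderiv_X]
  simp [Pi.single_apply, Prod.ext_iff]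

omit [Fintype ιx] [Fintype ιy] [Fintype κ] in
/-- Partial derivatives commute. [folklore] -/
private theorem pderiv_comm' (a b : (ιx ⊕ ιy) × κ) (f : MvPolynomial ((ιx ⊕ ιy) × κ) R) :
    pderiv a (pderiv b f) = pderiv b (pderiv a f) := by
  rcases eq_or_ne a b with rfl | hab
  · rfl
  ext m
  simp only [coeff_pderiv, Finsupp.add_apply, Finsupp.single_apply, if_neg hab,
    if_neg hab.symm, add_zero]
  rw [add_right_comm m (Finsupp.single a 1) (Finsupp.single b 1)]
  ring

omit [Fintype ιx] [Fintype ιy] [Fintype κ] [DecidableEq ιx] [DecidableEq ιy] [DecidableEq κ] in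
/-- A substitution fixes scalars. [folklore] -/
private theorem aeval_C' (v : (ιx ⊕ ιy) × κ → MvPolynomial ((ιx ⊕ ιy) × κ) R) (c : R) :
    aeval v (C c : MvPolynomial ((ιx ⊕ ιy) × κ) R) = C c := by
  rw [aeval_C]; rfl

/-! ## § 1. The chain rule for a substitution of the column index -/

omit [Fintype ιx] [Fintype ιy] [DecidableEq ιx] [DecidableEq ιy] in
/-- **Chain rule for `(x, y) ↦ (x·Bx, y·By)`** (row-dependent column substitution
`w (u, ν) = Σ_{ν′} B_u ν′ ν · x_{(u,ν′)}`): `∂_{(u,ν′)}(f∘w) = Σ_ν (B_u)_{ν′ν} (∂_{(u,ν)} f)∘w`.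
[cite: KashiwaraVergne1978, III (5.1) p. 41 (the action (x, y) ↦ (xc⁻¹, yᵗc))] -/
theorem pderiv_aeval_colSubst (B : ιx ⊕ ιy → Matrix κ κ R)
    (w : (ιx ⊕ ιy) × κ → MvPolynomial ((ιx ⊕ ιy) × κ) R)
    (hw : ∀ u ν, w (u, ν) = ∑ ν' : κ, C (B u ν' ν) * X (u, ν')) (u : ιx ⊕ ιy) (ν' : κ)
    (f : MvPolynomial ((ιx ⊕ ιy) × κ) R) :
    pderiv (u, ν') (aeval w f) = ∑ ν : κ, C (B u ν' ν) * aeval w (pderiv (u, ν) f) := by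
  classical
  have hdw : ∀ (u₀ : ιx ⊕ ιy) (ν : κ), pderiv (u, ν') (w (u₀, ν)) =
      if u₀ = u then C (B u ν' ν) else 0 := by
    intro u₀ ν
    rw [hw, map_sum, Finset.sum_eq_single ν']
    · rw [pderiv_C_mul, pderiv_X_pair]
      by_cases h : u₀ = u
      · subst h; simp
      · rw [if_neg (fun h' => h h'.1), if_neg h, mul_zero]
    · intro ν₁ _ hν₁
      rw [pderiv_C_mul, pderiv_X_pair, if_neg (fun h => hν₁ h.2), mul_zero]
    · intro h; exact absurd (Finset.mem_univ ν') h
  induction f using MvPolynomial.induction_on with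
  | C c =>
    simp only [pderiv_C, map_zero, mul_zero, Finset.sum_const_zero, aeval_C']
  | add f g hf hg =>
    rw [map_add, map_add, hf, hg, ← Finset.sum_add_distrib]
    refine Finset.sum_congr rfl fun ν _ => ?_
    rw [map_add, map_add, mul_add]
  | mul_X f z hf =>
    obtain ⟨u₀, ν₀⟩ := z
    have hr : ∀ ν : κ, C (B u ν' ν) * aeval w (pderiv (u, ν) (f * X (u₀, ν₀))) =
        C (B u ν' ν) * aeval w (pderiv (u, ν) f) * w (u₀, ν₀) +
          (if u₀ = u ∧ ν₀ = ν then C (B u ν' ν) * aeval w f else 0) := by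
      intro ν
      rw [pderiv_mul, pderiv_X_pair]
      split_ifs with h
      · rw [mul_one, map_add, map_mul, aeval_X]; ring
      · rw [mul_zero, add_zero, map_mul, aeval_X]; ring
    have hs : ∑ ν : κ, (if u₀ = u ∧ ν₀ = ν then C (B u ν' ν) * aeval w f else 0) =
        if u₀ = u then C (B u ν' ν₀) * aeval w f else 0 := by
      rw [Finset.sum_eq_single ν₀]
      · by_cases h : u₀ = u
        · rw [if_pos ⟨h, rfl⟩, if_pos h]
        · rw [if_neg (fun h' => h h'.1), if_neg h]
      · intro ν _ hν
        rw [if_neg (fun h => hν h.2.symm)]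
      · intro h; exact absurd (Finset.mem_univ ν₀) h
    rw [map_mul, aeval_X, pderiv_mul, hf, hdw, Finset.sum_congr rfl fun ν _ => hr ν,
      Finset.sum_add_distrib, hs, Finset.sum_mul]
    split_ifs <;> ring

/-! ## § 2. The row action `(x, y) ↦ (A x, B y)` -/

omit [Fintype κ] [DecidableEq ιx] [DecidableEq ιy] [DecidableEq κ] in
/-- The block-diagonal substitution on the `x`-rows. [folklore] -/
private theorem rowSubst_inl (A : Matrix ιx ιx R) (B : Matrix ιy ιy R)
    (v : (ιx ⊕ ιy) × κ → MvPolynomial ((ιx ⊕ ιy) × κ) R)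
    (hv : ∀ u ν, v (u, ν) = ∑ w : ιx ⊕ ιy, C (Matrix.fromBlocks A 0 0 B u w) * X (w, ν))
    (i : ιx) (ν : κ) : v (Sum.inl i, ν) = ∑ i' : ιx, C (A i i') * X (Sum.inl i', ν) := by
  rw [hv, Fintype.sum_sum_type]
  have h2 : ∑ j' : ιy, C (Matrix.fromBlocks A 0 0 B (Sum.inl i) (Sum.inr j')) *
      X (Sum.inr j', ν) = (0 : MvPolynomial ((ιx ⊕ ιy) × κ) R) :=
    Finset.sum_eq_zero fun j' _ => by rw [Matrix.fromBlocks_apply₁₂, Matrix.zero_apply, map_zero, zero_mul]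
  rw [h2, add_zero]
  exact Finset.sum_congr rfl fun i' _ => by rw [Matrix.fromBlocks_apply₁₁]

omit [Fintype κ] [DecidableEq ιx] [DecidableEq ιy] [DecidableEq κ] in
/-- The block-diagonal substitution on the `y`-rows. [folklore] -/
private theorem rowSubst_inr (A : Matrix ιx ιx R) (B : Matrix ιy ιy R)
    (v : (ιx ⊕ ιy) × κ → MvPolynomial ((ιx ⊕ ιy) × κ) R)
    (hv : ∀ u ν, v (u, ν) = ∑ w : ιx ⊕ ιy, C (Matrix.fromBlocks A 0 0 B u w) * X (w, ν))
    (j : ιy) (ν : κ) : v (Sum.inr j, ν) = ∑ j' : ιy, C (B j j') * X (Sum.inr j', ν) := by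
  rw [hv, Fintype.sum_sum_type]
  have h1 : ∑ i' : ιx, C (Matrix.fromBlocks A 0 0 B (Sum.inr j) (Sum.inl i')) *
      X (Sum.inl i', ν) = (0 : MvPolynomial ((ιx ⊕ ιy) × κ) R) :=
    Finset.sum_eq_zero fun i' _ => by rw [Matrix.fromBlocks_apply₂₁, Matrix.zero_apply, map_zero, zero_mul]
  rw [h1, zero_add]
  exact Finset.sum_congr rfl fun j' _ => by rw [Matrix.fromBlocks_apply₂₂]

omit [Fintype κ] in
/-- Chain rule for the row action on an `x`-derivative:
`∂_{(inl i, ν)}(f∘v) = Σ_{i′} A_{i′i} (∂_{(inl i′, ν)} f)∘v`. [folklore] -/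
private theorem pderiv_inl_aeval_rowSubst (A : Matrix ιx ιx R) (B : Matrix ιy ιy R)
    (v : (ιx ⊕ ιy) × κ → MvPolynomial ((ιx ⊕ ιy) × κ) R)
    (hv : ∀ u ν, v (u, ν) = ∑ w : ιx ⊕ ιy, C (Matrix.fromBlocks A 0 0 B u w) * X (w, ν))
    (i : ιx) (ν : κ) (f : MvPolynomial ((ιx ⊕ ιy) × κ) R) :
    pderiv (Sum.inl i, ν) (aeval v f) =
      ∑ i' : ιx, C (A i' i) * aeval v (pderiv (Sum.inl i', ν) f) := by
  have hv' : ∀ (p : ιx ⊕ ιy) (ν : κ), v (p, ν) =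
      ∑ q : ιx ⊕ ιy, C (Matrix.fromBlocks A 0 0 B p q) * X (q, ν) := hv
  rw [ClassicalInvariants.OnSpDualityOperators.pderiv_aeval_linSubst _ v hv', Fintype.sum_sum_type]
  have h2 : ∑ j' : ιy, C (Matrix.fromBlocks A 0 0 B (Sum.inr j') (Sum.inl i)) *
      aeval v (pderiv (Sum.inr j', ν) f) = 0 :=
    Finset.sum_eq_zero fun j' _ => by rw [Matrix.fromBlocks_apply₂₁, Matrix.zero_apply, map_zero, zero_mul]
  rw [h2, add_zero]
  exact Finset.sum_congr rfl fun i' _ => by rw [Matrix.fromBlocks_apply₁₁]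

omit [Fintype κ] in
/-- Chain rule for the row action on a `y`-derivative:
`∂_{(inr j, ν)}(f∘v) = Σ_{j′} B_{j′j} (∂_{(inr j′, ν)} f)∘v`. [folklore] -/
private theorem pderiv_inr_aeval_rowSubst (A : Matrix ιx ιx R) (B : Matrix ιy ιy R)
    (v : (ιx ⊕ ιy) × κ → MvPolynomial ((ιx ⊕ ιy) × κ) R)
    (hv : ∀ u ν, v (u, ν) = ∑ w : ιx ⊕ ιy, C (Matrix.fromBlocks A 0 0 B u w) * X (w, ν))
    (j : ιy) (ν : κ) (f : MvPolynomial ((ιx ⊕ ιy) × κ) R) :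
    pderiv (Sum.inr j, ν) (aeval v f) =
      ∑ j' : ιy, C (B j' j) * aeval v (pderiv (Sum.inr j', ν) f) := by
  have hv' : ∀ (p : ιx ⊕ ιy) (ν : κ), v (p, ν) =
      ∑ q : ιx ⊕ ιy, C (Matrix.fromBlocks A 0 0 B p q) * X (q, ν) := hv
  rw [ClassicalInvariants.OnSpDualityOperators.pderiv_aeval_linSubst _ v hv', Fintype.sum_sum_type]
  have h1 : ∑ i' : ιx, C (Matrix.fromBlocks A 0 0 B (Sum.inl i') (Sum.inr j)) *
      aeval v (pderiv (Sum.inl i', ν) f) = 0 :=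
    Finset.sum_eq_zero fun i' _ => by rw [Matrix.fromBlocks_apply₁₂, Matrix.zero_apply, map_zero, zero_mul]
  rw [h1, zero_add]
  exact Finset.sum_congr rfl fun j' _ => by rw [Matrix.fromBlocks_apply₂₂]

/-- **`Δ_ij` under the row action** `(x, y) ↦ (A x, B y)` (the block-diagonal substitution
`v (u, ν) = Σ_w a_{uw} x_{(w,ν)}`, `a = fromBlocks A 0 0 B`):
`Δ_ij(f∘v) = Σ_{i′,j′} A_{i′i} B_{j′j} · (Δ_{i′j′} f)∘v`. [cite: KashiwaraVergne1978, III (5.1) p. 41] -/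
theorem laplacianKV_aeval_rowSubst
    (Δ : ιx → ιy → MvPolynomial ((ιx ⊕ ιy) × κ) R →ₗ[R] MvPolynomial ((ιx ⊕ ιy) × κ) R)
    (hΔ : ∀ i j f, Δ i j f = ∑ ν : κ, pderiv (Sum.inl i, ν) (pderiv (Sum.inr j, ν) f))
    (A : Matrix ιx ιx R) (B : Matrix ιy ιy R)
    (v : (ιx ⊕ ιy) × κ → MvPolynomial ((ιx ⊕ ιy) × κ) R)
    (hv : ∀ u ν, v (u, ν) = ∑ w : ιx ⊕ ιy, C (Matrix.fromBlocks A 0 0 B u w) * X (w, ν))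
    (i : ιx) (j : ιy) (f : MvPolynomial ((ιx ⊕ ιy) × κ) R) :
    Δ i j (aeval v f) = ∑ i' : ιx, ∑ j' : ιy, C (A i' i * B j' j) * aeval v (Δ i' j' f) := by
  have step : ∀ ν : κ, pderiv (Sum.inl i, ν) (pderiv (Sum.inr j, ν) (aeval v f)) =
      ∑ j' : ιy, ∑ i' : ιx, C (A i' i * B j' j) *
        aeval v (pderiv (Sum.inl i', ν) (pderiv (Sum.inr j', ν) f)) := by
    intro ν
    rw [pderiv_inr_aeval_rowSubst A B v hv, map_sum]
    refine Finset.sum_congr rfl fun j' _ => ?_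
    rw [pderiv_C_mul, pderiv_inl_aeval_rowSubst A B v hv, Finset.mul_sum]
    refine Finset.sum_congr rfl fun i' _ => ?_
    rw [map_mul]; ring
  calc Δ i j (aeval v f)
      = ∑ ν : κ, ∑ j' : ιy, ∑ i' : ιx, C (A i' i * B j' j) *
          aeval v (pderiv (Sum.inl i', ν) (pderiv (Sum.inr j', ν) f)) := by
        rw [hΔ]; exact Finset.sum_congr rfl fun ν _ => step ν
    _ = ∑ i' : ιx, ∑ j' : ιy, ∑ ν : κ, C (A i' i * B j' j) *
          aeval v (pderiv (Sum.inl i', ν) (pderiv (Sum.inr j', ν) f)) := by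
        rw [Finset.sum_comm]
        refine (Finset.sum_congr rfl fun j' _ => Finset.sum_comm).trans ?_
        rw [Finset.sum_comm]
    _ = ∑ i' : ιx, ∑ j' : ιy, C (A i' i * B j' j) * aeval v (Δ i' j' f) := by
        refine Finset.sum_congr rfl fun i' _ => Finset.sum_congr rfl fun j' _ => ?_
        rw [hΔ, map_sum, Finset.mul_sum]

/-- Hence **the pluriharmonics are stable under the row action of `GL(p) × GL(q)`** ("so `𝔥` is a
representation space"). [cite: KashiwaraVergne1978, III (5.1) p. 41] -/
theorem isPluriharmonic_aeval_rowSubst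
    (Δ : ιx → ιy → MvPolynomial ((ιx ⊕ ιy) × κ) R →ₗ[R] MvPolynomial ((ιx ⊕ ιy) × κ) R)
    (hΔ : ∀ i j f, Δ i j f = ∑ ν : κ, pderiv (Sum.inl i, ν) (pderiv (Sum.inr j, ν) f))
    (A : Matrix ιx ιx R) (B : Matrix ιy ιy R)
    (v : (ιx ⊕ ιy) × κ → MvPolynomial ((ιx ⊕ ιy) × κ) R)
    (hv : ∀ u ν, v (u, ν) = ∑ w : ιx ⊕ ιy, C (Matrix.fromBlocks A 0 0 B u w) * X (w, ν))
    {f : MvPolynomial ((ιx ⊕ ιy) × κ) R} (hf : ∀ i j, Δ i j f = 0) (i : ιx) (j : ιy) :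
    Δ i j (aeval v f) = 0 := by
  rw [laplacianKV_aeval_rowSubst Δ hΔ A B v hv]
  exact Finset.sum_eq_zero fun i' _ => Finset.sum_eq_zero fun j' _ => by
    rw [hf, map_zero, mul_zero]

omit [DecidableEq ιx] [DecidableEq ιy] [DecidableEq κ] in
/-- The quadrics `(xᵗy)_{ij} = Σ_ν x_{iν} y_{jν}` are **covariant under the row action**:
`(xᵗy)_{ij}∘v = Σ_{i′,j′} A_{ii′} B_{jj′} (xᵗy)_{i′j′}`. [cite: KashiwaraVergne1978, III (5.2) p. 41–42] -/
theorem aeval_rowSubst_T (T : ιx → ιy → MvPolynomial ((ιx ⊕ ιy) × κ) R)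
    (hT : ∀ i j, T i j = ∑ ν : κ, X (Sum.inl i, ν) * X (Sum.inr j, ν))
    (A : Matrix ιx ιx R) (B : Matrix ιy ιy R)
    (v : (ιx ⊕ ιy) × κ → MvPolynomial ((ιx ⊕ ιy) × κ) R)
    (hv : ∀ u ν, v (u, ν) = ∑ w : ιx ⊕ ιy, C (Matrix.fromBlocks A 0 0 B u w) * X (w, ν))
    (i : ιx) (j : ιy) :
    aeval v (T i j) = ∑ i' : ιx, ∑ j' : ιy, C (A i i' * B j j') * T i' j' := by
  have step : ∀ ν : κ,
      aeval v (X (Sum.inl i, ν) * X (Sum.inr j, ν) : MvPolynomial ((ιx ⊕ ιy) × κ) R) =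
      ∑ i' : ιx, ∑ j' : ιy, C (A i i' * B j j') * (X (Sum.inl i', ν) * X (Sum.inr j', ν)) := by
    intro ν
    rw [map_mul, aeval_X, aeval_X, rowSubst_inl A B v hv, rowSubst_inr A B v hv,
      Finset.sum_mul_sum]
    refine Finset.sum_congr rfl fun i' _ => Finset.sum_congr rfl fun j' _ => ?_
    rw [map_mul]; ring
  calc aeval v (T i j)
      = ∑ ν : κ, ∑ i' : ιx, ∑ j' : ιy, C (A i i' * B j j') *
          (X (Sum.inl i', ν) * X (Sum.inr j', ν)) := by
        rw [hT, map_sum]; exact Finset.sum_congr rfl fun ν _ => step ν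
    _ = ∑ i' : ιx, ∑ j' : ιy, ∑ ν : κ, C (A i i' * B j j') *
          (X (Sum.inl i', ν) * X (Sum.inr j', ν)) := by
        rw [Finset.sum_comm]
        exact Finset.sum_congr rfl fun i' _ => Finset.sum_comm
    _ = ∑ i' : ιx, ∑ j' : ιy, C (A i i' * B j j') * T i' j' := by
        refine Finset.sum_congr rfl fun i' _ => Finset.sum_congr rfl fun j' _ => ?_
        rw [hT, Finset.mul_sum]

/-! ## § 3. The column action `(x, y) ↦ (x·Bx, y·By)` with `Bxᵀ By = 1` -/

omit [Fintype ιx] [Fintype ιy] [DecidableEq ιx] [DecidableEq ιy] in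
/-- **Each `Δ_ij` is invariant under the column action** `(x, y) ↦ (x·Bx, y·By)` when
`Bxᵀ By = 1` (the book's `(xc⁻¹, yᵗc)`: `Bx = c⁻¹`, `By = ᵗc`): `Δ_ij(f∘w) = (Δ_ij f)∘w`.
[cite: KashiwaraVergne1978, III (5.1) p. 41] -/
theorem laplacianKV_aeval_colSubst
    (Δ : ιx → ιy → MvPolynomial ((ιx ⊕ ιy) × κ) R →ₗ[R] MvPolynomial ((ιx ⊕ ιy) × κ) R)
    (hΔ : ∀ i j f, Δ i j f = ∑ ν : κ, pderiv (Sum.inl i, ν) (pderiv (Sum.inr j, ν) f))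
    (Bx By : Matrix κ κ R) (hB : Bx.transpose * By = 1)
    (w : (ιx ⊕ ιy) × κ → MvPolynomial ((ιx ⊕ ιy) × κ) R)
    (hw : ∀ u ν, w (u, ν) = ∑ ν' : κ, C (Sum.elim (fun _ => Bx) (fun _ => By) u ν' ν) * X (u, ν'))
    (i : ιx) (j : ιy) (f : MvPolynomial ((ιx ⊕ ιy) × κ) R) :
    Δ i j (aeval w f) = aeval w (Δ i j f) := by
  have hsum : ∀ ν₁ ν₂ : κ, ∑ ν : κ, Bx ν ν₁ * By ν ν₂ = if ν₁ = ν₂ then 1 else 0 := by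
    intro ν₁ ν₂
    have := congrFun (congrFun hB ν₁) ν₂
    rw [Matrix.mul_apply, Matrix.one_apply] at this
    simpa [Matrix.transpose_apply] using this
  rw [hΔ, hΔ, map_sum]
  simp_rw [pderiv_aeval_colSubst _ w hw, map_sum, pderiv_C_mul, pderiv_aeval_colSubst _ w hw,
    Sum.elim_inl, Sum.elim_inr, Finset.mul_sum]
  calc ∑ ν : κ, ∑ ν₂ : κ, ∑ ν₁ : κ, C (By ν ν₂) *
          (C (Bx ν ν₁) * aeval w (pderiv (Sum.inl i, ν₁) (pderiv (Sum.inr j, ν₂) f)))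
      = ∑ ν₂ : κ, ∑ ν₁ : κ, C (∑ ν : κ, Bx ν ν₁ * By ν ν₂) *
          aeval w (pderiv (Sum.inl i, ν₁) (pderiv (Sum.inr j, ν₂) f)) := by
        rw [Finset.sum_comm]
        refine Finset.sum_congr rfl fun ν₂ _ => ?_
        rw [Finset.sum_comm]
        refine Finset.sum_congr rfl fun ν₁ _ => ?_
        rw [map_sum, Finset.sum_mul]
        refine Finset.sum_congr rfl fun ν _ => ?_
        rw [map_mul]; ring
    _ = ∑ ν : κ, aeval w (pderiv (Sum.inl i, ν) (pderiv (Sum.inr j, ν) f)) := by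
        refine Finset.sum_congr rfl fun ν₂ _ => ?_
        rw [Finset.sum_eq_single ν₂]
        · rw [hsum, if_pos rfl, map_one, one_mul]
        · intro ν₁ _ h
          rw [hsum, if_neg h, map_zero, zero_mul]
        · intro h; exact absurd (Finset.mem_univ ν₂) h

omit [Fintype ιx] [Fintype ιy] [DecidableEq ιx] [DecidableEq ιy] in
/-- Hence **the pluriharmonics are stable under the column action of `GL(k)`**.
[cite: KashiwaraVergne1978, III (5.1) p. 41] -/
theorem isPluriharmonic_aeval_colSubst
    (Δ : ιx → ιy → MvPolynomial ((ιx ⊕ ιy) × κ) R →ₗ[R] MvPolynomial ((ιx ⊕ ιy) × κ) R)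
    (hΔ : ∀ i j f, Δ i j f = ∑ ν : κ, pderiv (Sum.inl i, ν) (pderiv (Sum.inr j, ν) f))
    (Bx By : Matrix κ κ R) (hB : Bx.transpose * By = 1)
    (w : (ιx ⊕ ιy) × κ → MvPolynomial ((ιx ⊕ ιy) × κ) R)
    (hw : ∀ u ν, w (u, ν) = ∑ ν' : κ, C (Sum.elim (fun _ => Bx) (fun _ => By) u ν' ν) * X (u, ν'))
    {f : MvPolynomial ((ιx ⊕ ιy) × κ) R} (hf : ∀ i j, Δ i j f = 0) (i : ιx) (j : ιy) :
    Δ i j (aeval w f) = 0 := by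
  rw [laplacianKV_aeval_colSubst Δ hΔ Bx By hB w hw, hf, map_zero]

omit [Fintype ιx] [Fintype ιy] [DecidableEq ιx] [DecidableEq ιy] in
/-- The quadrics `(xᵗy)_{ij}` are **invariant under the column action** when `Bxᵀ By = 1`:
`(xᵗy)_{ij}∘w = (xᵗy)_{ij}` (`x c⁻¹ ᵗ(y ᵗc) = x ᵗy`). [cite: KashiwaraVergne1978, III (5.2) p. 41–42] -/
theorem aeval_colSubst_T (T : ιx → ιy → MvPolynomial ((ιx ⊕ ιy) × κ) R)
    (hT : ∀ i j, T i j = ∑ ν : κ, X (Sum.inl i, ν) * X (Sum.inr j, ν))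
    (Bx By : Matrix κ κ R) (hB : Bx.transpose * By = 1)
    (w : (ιx ⊕ ιy) × κ → MvPolynomial ((ιx ⊕ ιy) × κ) R)
    (hw : ∀ u ν, w (u, ν) = ∑ ν' : κ, C (Sum.elim (fun _ => Bx) (fun _ => By) u ν' ν) * X (u, ν'))
    (i : ιx) (j : ιy) : aeval w (T i j) = T i j := by
  -- `Bx Byᵀ = 1` as well
  have hB' : Bx * By.transpose = 1 := by
    have h1 : By * Bx.transpose = 1 := mul_eq_one_comm.mp hB
    have := congrArg Matrix.transpose h1
    rwa [Matrix.transpose_mul, Matrix.transpose_transpose, Matrix.transpose_one] at this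
  have hsum : ∀ ν₁ ν₂ : κ, ∑ ν : κ, Bx ν₁ ν * By ν₂ ν = if ν₁ = ν₂ then 1 else 0 := by
    intro ν₁ ν₂
    have := congrFun (congrFun hB' ν₁) ν₂
    rw [Matrix.mul_apply, Matrix.one_apply] at this
    simpa [Matrix.transpose_apply] using this
  rw [hT, map_sum]
  simp_rw [map_mul, aeval_X, hw, Sum.elim_inl, Sum.elim_inr]
  calc ∑ ν : κ, (∑ ν₁ : κ, C (Bx ν₁ ν) * X (Sum.inl i, ν₁)) * (∑ ν₂ : κ, C (By ν₂ ν) * X (Sum.inr j, ν₂))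
      = ∑ ν₁ : κ, ∑ ν₂ : κ, C (∑ ν : κ, Bx ν₁ ν * By ν₂ ν) * (X (Sum.inl i, ν₁) * X (Sum.inr j, ν₂)) := by
        simp_rw [Finset.sum_mul_sum]
        rw [Finset.sum_comm]
        refine Finset.sum_congr rfl fun ν₁ _ => ?_
        rw [Finset.sum_comm]
        refine Finset.sum_congr rfl fun ν₂ _ => ?_
        rw [map_sum, Finset.sum_mul]
        refine Finset.sum_congr rfl fun ν _ => ?_
        rw [map_mul]; ring
    _ = ∑ ν : κ, X (Sum.inl i, ν) * X (Sum.inr j, ν) := by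
        refine Finset.sum_congr rfl fun ν₁ _ => ?_
        rw [Finset.sum_eq_single ν₁]
        · rw [hsum, if_pos rfl, map_one, one_mul]
        · intro ν₂ _ h
          rw [hsum, if_neg (Ne.symm h), map_zero, zero_mul]
        · intro h; exact absurd (Finset.mem_univ ν₁) h

end Literature.RepresentationTheory.KashiwaraVergne1978.PluriharmonicInvariance
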